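import Mathlib
import Summits.NavierStokesRegularity.NavierStokesRegularity.Theorems.SubOnsagerCeilingKPNoBlowupCorners
import Summits.NavierStokesRegularity.NavierStokesRegularity.Theorems.SubOnsagerCeilingKPStarvedNetworkBarrier
import HarnessLib

/-!
# Starved KP networks: the rung target's body at every small scale ratio, in the `∃ εR` shape the route consumes
(helper file for the crux `SubOnsagerCeiling.ForwardTailCeilingKP`, stmt-NavierStokesRegularity-27057, `--supports`;
hand leafhand-ns-subonsagerceiling-4 gen 22 — companion of `SubOnsagerCeilingSmallRatioSuffices` / `SubOnsagerCeilingKPNoBlowupCorners`)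

The STARVED-NETWORK corner of hands leafhand-2/3 (`starvedNetwork_ceilingAt`, `Theorems/SubOnsagerCeilingKPStarvedNetworkBarrier.lean`):
a KP network proper whose live modes leak into a dead pocket set `Q` with GRAM MARGIN `r` (exits dominate live feeds:
`r·Σ_{e∉Q} α_aae α_cce ≤ Σ_{d∈Q} (P_ad P_cd + α_aad α_ccd)`) obeys `CeilingAt R ε₀ α` at EVERY scale ratio with `ε₀ < r`.  This is
exactly the shape of the SMALL-RATIO KP ceiling that the route's deciding theorem consumes (`taoLadderTarget_of_kpSmallRatioCeiling`:
`∀ R ≥ 1, ∃ εR > 0, ∀ ε₀ ≤ εR, …`): on the class of starved networks with margin `≥ r` one may take `εR = r/2`, uniformly in `R`.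
Recorded here BY NAME:

* `starvedNetwork_not_noGlobalCascade` — per table, per ratio `ε₀ < r`: `¬NoGlobalCascade ε₀ α X₀` for every datum (the rung target's
  body), modulo the closed item `OrthantInvariance` (hypothesis);
* `starvedNetwork_smallRatioTarget` — the `∃ εR` form: for every margin `r > 0` and every spread `R` there is `εR = r/2 > 0` such that
  every starved network of margin `r` in `E₂(R)` (orthant, diagonal feeds) has `¬NoGlobalCascade ε₀ α X₀` for all `ε₀ ∈ (0, εR]` and all
  data — i.e. `TaoLadderRungTwoBreak.Target` RESTRICTED to this class, modulo `OrthantInvariance`.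

HONEST FRAMING: bookkeeping about Tao-type MODEL lattice ODEs (route SubOnsagerCeiling, rung TL-M2Break); a class corner of the rung
target, not the target; nothing here bears on Navier–Stokes regularity. [cite: Tao2016AveragedNS, §4 Thm. 4.2, (4.13)]
-/

noncomputable section

-- the sub-problem namespace `NavierStokesRegularity.NavierStokesRegularity` is the tree's layout (D-0017)
set_option linter.dupNamespace false

namespace Summit.NavierStokesRegularity.NavierStokesRegularity.Theorems

open Literature.Analysis.FluidPDE.TaoCascade
open Summit.NavierStokesRegularity.NavierStokesRegularity.Theses.SubOnsagerCeiling
open Summit.NavierStokesRegularity.NavierStokesRegularity.Theorems.SubOnsagerCeiling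

/-- **Starved networks: no Theorem-4.2 blow-up at every scale ratio below the Gram margin.**  Hypotheses = those of
`starvedNetwork_ceilingAt` (pumps `P ≥ 0` only into the pocket set `Q`, pockets inert, Gram margin `r > ε₀`, diagonal feeds, no
differential in-shell triads) plus the table-class and orthant binders and the closed item `OrthantInvariance`; conclusion
`¬NoGlobalCascade ε₀ α X₀` for every one-shell datum. [cite: Tao2016AveragedNS, §4 Thm. 4.2] -/
theorem starvedNetwork_not_noGlobalCascade {α : Fin 4 → Fin 4 → Fin 4 → ℤ × ℤ × ℤ → ℝ} {P : Fin 4 → Fin 4 → ℝ}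
    {Q : Finset (Fin 4)} {ε₀ r : ℝ} (hε : 0 < ε₀) (hPnn : ∀ a d, 0 ≤ P a d) (hgap : ε₀ < r)
    (hGram : ∀ a c : Fin 4, a ∉ Q → c ∉ Q →
      r * ∑ e ∈ Qᶜ, α a a e (0, 0, 1) * α c c e (0, 0, 1) ≤
        ∑ d ∈ Q, (P a d * P c d + α a a d (0, 0, 1) * α c c d (0, 0, 1)))
    (hD : ∀ a b i : Fin 4, a ≠ b → α a b i (0, 0, 1) = 0)
    (hPump : ∀ a d : Fin 4, α a a d (0, 0, 0) = P a d)
    (hCz : ∀ a b d : Fin 4, a ≠ b → a ≠ d → b ≠ d → α a b d (0, 0, 0) = 0)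
    (hQw : ∀ d ∈ Q, ∀ e : Fin 4, α d d e (0, 0, 1) = 0)
    (hQP : ∀ d ∈ Q, ∀ j : Fin 4, P d j = 0)
    (hPQ : ∀ a j : Fin 4, j ∉ Q → P a j = 0) {R : ℝ}
    (hT : Literature.Analysis.FluidPDE.TaoCascade.InTableClass R α)
    (hK : ∀ (Y : Fin 4 → ℤ → ℝ → ℝ) (τ : ℝ), (∀ (j : Fin 4) (k : ℤ), 1 ≤ k → 0 ≤ Y j k τ) → ∀ δ : ℝ, 0 < δ →
      ∀ (i : Fin 4) (n : ℤ), 1 ≤ n → Y i n τ = 0 → 0 ≤ Literature.Analysis.FluidPDE.TaoCascade.quadTerm δ α Y i n τ)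
    (hI : OrthantInvariance) (X₀ : Fin 4 → ℝ) :
    ¬ Literature.Analysis.FluidPDE.TaoCascade.NoGlobalCascade ε₀ α X₀ :=
  kp_not_noGlobalCascade_of_ceilingAt hε (starvedNetwork_ceilingAt hε hPnn hgap hGram hD hPump hCz hQw hQP hPQ R) hT hK hI X₀

/-- **Starved networks of margin `r`: the rung target restricted to the class, in the route's `∃ εR` shape** (`εR = r/2`, uniform in the
spread `R`): for all `ε₀ ∈ (0, εR]`, every starved network of Gram margin `r` which is an orthant diagonal-feed table of `E₂(R)`, and every
datum, `¬NoGlobalCascade ε₀ α X₀` — modulo the closed item `OrthantInvariance`. A class corner of `TaoLadderRungTwoBreak.Target` through the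
small-ratio KP ceiling; MODEL lattice only. [cite: Tao2016AveragedNS, §4 Thm. 4.2] -/
theorem starvedNetwork_smallRatioTarget {r : ℝ} (hr : 0 < r) (hI : OrthantInvariance) :
    ∀ R : ℝ, 1 ≤ R → ∃ εR : ℝ, 0 < εR ∧ ∀ ε₀ : ℝ, 0 < ε₀ → ε₀ ≤ εR →
      ∀ (α : Fin 4 → Fin 4 → Fin 4 → ℤ × ℤ × ℤ → ℝ) (P : Fin 4 → Fin 4 → ℝ) (Q : Finset (Fin 4)),
      (∀ a d, 0 ≤ P a d) →
      (∀ a c : Fin 4, a ∉ Q → c ∉ Q →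
        r * ∑ e ∈ Qᶜ, α a a e (0, 0, 1) * α c c e (0, 0, 1) ≤
          ∑ d ∈ Q, (P a d * P c d + α a a d (0, 0, 1) * α c c d (0, 0, 1))) →
      (∀ a b i : Fin 4, a ≠ b → α a b i (0, 0, 1) = 0) →
      (∀ a d : Fin 4, α a a d (0, 0, 0) = P a d) →
      (∀ a b d : Fin 4, a ≠ b → a ≠ d → b ≠ d → α a b d (0, 0, 0) = 0) →
      (∀ d ∈ Q, ∀ e : Fin 4, α d d e (0, 0, 1) = 0) →
      (∀ d ∈ Q, ∀ j : Fin 4, P d j = 0) →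
      (∀ a j : Fin 4, j ∉ Q → P a j = 0) →
      Literature.Analysis.FluidPDE.TaoCascade.InTableClass R α →
      (∀ (Y : Fin 4 → ℤ → ℝ → ℝ) (τ : ℝ), (∀ (j : Fin 4) (k : ℤ), 1 ≤ k → 0 ≤ Y j k τ) → ∀ δ : ℝ, 0 < δ →
        ∀ (i : Fin 4) (n : ℤ), 1 ≤ n → Y i n τ = 0 → 0 ≤ Literature.Analysis.FluidPDE.TaoCascade.quadTerm δ α Y i n τ) →
      ∀ X₀ : Fin 4 → ℝ, ¬ Literature.Analysis.FluidPDE.TaoCascade.NoGlobalCascade ε₀ α X₀ := by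
  intro R _hR
  refine ⟨r / 2, by positivity, ?_⟩
  intro ε₀ h0 hle α P Q hPnn hGram hD hPump hCz hQw hQP hPQ hT hK X₀
  exact starvedNetwork_not_noGlobalCascade h0 hPnn (by linarith) hGram hD hPump hCz hQw hQP hPQ hT hK hI X₀

end Summit.NavierStokesRegularity.NavierStokesRegularity.Theorems

end
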